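import Literature.AlgebraicGeometry.Morphisms.CechModuleSheafHom
import Summits.ResolutionOfSingularities.ResolutionOfSingularities.Theorems.HomologicalConductorNoZenoFullSheafPresentation
import Summits.ResolutionOfSingularities.ResolutionOfSingularities.Theorems.HomologicalConductorNoZenoSheafHomBiproduct
import HarnessLib

/-!
# Crux `NoZenoR` / `NoZeno` (stmt-ResolutionOfSingularities-19943 / -16483), line `sandwich-cluster`,
# G-layer, G2 assembly items A3 and A6 IN THE HOLDER'S VOCABULARY: the Čech exactness data of
# `0 → 𝓗om(𝒪_X·S, 𝒦) → 𝓗om(𝒪_X·S, 𝒪_X^n) → 𝓔nd(𝒪_X·S) → 0` for the presentation `𝒪_X^n ↠ 𝒪_X·S`, and the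
# surjectivity of its connecting homomorphism

OURS (cell res-hironaka, chain W4.4, res-L0-w44-stub-4 for the G2 holder res-D-pv-045 AS
res-L0-w44-stub-8; plan `D/res-D-pv-045/SketchG2Assembly.lean`, items A3 `cechExactData_sheafHom_presentation`
and A6 `cechDelta_surjective_of_dual`). Nothing here is a statement of the manuscript under review
(Hironaka 2017) and nothing of `[claim: Hironaka2017]` is used; AI-written, weaker than expert review.

For `X` integral and locally noetherian, `V` a `K(X)`-vector space, `S ⊆ V`, the full sheaf
`𝒪_X · S = generatedSheaf V S` (p500643) and pv-024's presentation
`presentation V S s : 𝒪_X^n = freeMod X n ⟶ 𝒪_X · S` (p505917) attached to `s : Fin n → S`: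

* `cechExactData_sheafHom_presentation` (A3) — if the presentation is an epimorphism and `𝒪_X · S` is
  finite locally free, then on every family of AFFINE opens the sequence
  `𝓗om(𝒪_X·S, ker) → 𝓗om(𝒪_X·S, 𝒪_X^n) → 𝓔nd(𝒪_X·S)` carries the sectionwise exactness data
  `CechExactData` of `Morphisms/CechModuleExact` (instance of `CechExactData.sheafHom_kernel_of_isAffineLocalizing`,
  `Morphisms/CechModuleSheafHom`, p506732: `𝓗om(E, –)` is exact for `E` finite locally free, the kernel
  is affine-localizing, Hartshorne II Prop. 5.6 gives surjectivity on affine sections);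
* `cechDelta_surjective_sheafHom_presentation` (A6) — if moreover `Ȟ¹(𝒰, (𝒪_X·S)^∨) = 0`, the
  connecting homomorphism `δ : Ȟ⁰(𝒰, 𝓔nd(𝒪_X·S)) → Ȟ¹(𝒰, 𝓗om(𝒪_X·S, ker))` is onto
  (`Ȟ¹(𝒰, 𝓗om(𝒪_X·S, 𝒪_X^n)) = 0` by the holder's `subsingleton_cechMH1_sheafHom_free`, p505667, and
  exactness at `Ȟ¹(M')`, `CechExactData.cechDelta_surjective_of_subsingleton`).

Everything is proved; no named facts. [this work]
-/

-- single-problem summit: the doubled namespace component `ResolutionOfSingularities` is forced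
set_option linter.dupNamespace false

noncomputable section

universe u v

open CategoryTheory CategoryTheory.Limits AlgebraicGeometry TopologicalSpace Opposite
open Literature.AlgebraicGeometry.Morphisms Literature.AlgebraicGeometry.Modules
open Literature.AlgebraicGeometry.Motives

namespace Summit.ResolutionOfSingularities.ResolutionOfSingularities.Theorems.NoZeno.SandwichCluster.FullSheaf

variable {X : Scheme.{u}} [IsIntegral X]
variable (V : Type u) [AddCommGroup V] [Module X.functionField V] (S : Set V)
variable {A : Type u} [CommRing A] (f : X ⟶ Spec (.of A)) {ι : Type v} (U : ι → X.Opens)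

/-- **A3 — the Čech exactness data of `0 → 𝓗om(𝒪_X·S, 𝒦) → 𝓗om(𝒪_X·S, 𝒪_X^n) → 𝓔nd(𝒪_X·S) → 0`**
on a family of affine opens, for the presentation `𝒪_X^n ↠ 𝒪_X·S` (an epimorphism) of a finite locally
free full sheaf on a locally noetherian integral `X`. [this work] -/
theorem cechExactData_sheafHom_presentation [IsLocallyNoetherian X] {n : ℕ} (s : Fin n → S)
    [Epi (presentation (X := X) V S s)] (hLF : IsFiniteLocallyFree (generatedSheaf (X := X) V S))
    (hU : ∀ i, IsAffineOpen (U i)) :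
    CechExactData f U
      (sheafHomMap (generatedSheaf (X := X) V S) (kernel.ι (presentation (X := X) V S s)))
      (sheafHomMap (generatedSheaf (X := X) V S) (presentation (X := X) V S s)) :=
  CechExactData.sheafHom_kernel_of_isAffineLocalizing f U _ hLF _ (coh_freeMod (X := X) n).loc
    (isAffineLocalizing_generatedSheaf V S) hU

/-- **A6 — `δ : Ȟ⁰(𝒰, 𝓔nd(𝒪_X·S)) → Ȟ¹(𝒰, 𝓗om(𝒪_X·S, 𝒦))` is onto when `Ȟ¹(𝒰, (𝒪_X·S)^∨) = 0`**,
for the Čech exactness data of the presentation sequence through `𝓗om(𝒪_X·S, –)` (e.g.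
`cechExactData_sheafHom_presentation`): `Ȟ¹(𝒰, 𝓗om(𝒪_X·S, 𝒪_X^n)) = 0` by additivity over the free
module of finite rank. [this work] -/
theorem cechDelta_surjective_sheafHom_presentation {n : ℕ} (s : Fin n → S)
    (hdata : CechExactData f U
      (sheafHomMap (generatedSheaf (X := X) V S) (kernel.ι (presentation (X := X) V S s)))
      (sheafHomMap (generatedSheaf (X := X) V S) (presentation (X := X) V S s)))
    (hdual : Subsingleton (CechMH1 f (dual (generatedSheaf (X := X) V S)) U)) :
    Function.Surjective hdata.cechDelta :=
  hdata.cechDelta_surjective_of_subsingleton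
    (subsingleton_cechMH1_sheafHom_free f U (generatedSheaf (X := X) V S) (ULift.{u} (Fin n)) hdual)

/-- A3 + A6 combined: for the presentation of a finite locally free full sheaf with
`Ȟ¹(𝒰, (𝒪_X·S)^∨) = 0`, on a family of affine opens, the connecting homomorphism of
`cechExactData_sheafHom_presentation` is onto. [this work] -/
theorem cechDelta_surjective_sheafHom_presentation_of_dual [IsLocallyNoetherian X] {n : ℕ}
    (s : Fin n → S) [Epi (presentation (X := X) V S s)]
    (hLF : IsFiniteLocallyFree (generatedSheaf (X := X) V S)) (hU : ∀ i, IsAffineOpen (U i))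
    (hdual : Subsingleton (CechMH1 f (dual (generatedSheaf (X := X) V S)) U)) :
    Function.Surjective (cechExactData_sheafHom_presentation V S f U s hLF hU).cechDelta :=
  cechDelta_surjective_sheafHom_presentation V S f U s _ hdual

end Summit.ResolutionOfSingularities.ResolutionOfSingularities.Theorems.NoZeno.SandwichCluster.FullSheaf

end
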